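import Summits.CriticalPhenomena.PercolationContinuityZ3.Theorems.FK.VolumeExponentialDecayConsequences
import Summits.CriticalPhenomena.PercolationContinuityZ3.Theorems.FK.DecayRatePositiveBelowPcOne
import Summits.CriticalPhenomena.PercolationContinuityZ3.Theorems.FK.VolumeDecayRatePositiveBelowPcOne
import HarnessLib

/-!
# Below the finite-volume threshold `p̃_c^a(q)` the decay rates are positive: `ζ^b(p,q) > 0`, `ψ^b(p,q) > 0`, and
# the two-point function decays exponentially in every direction (Grimmett 2006, Thm. (5.86) with (5.42)–(5.47),
# (5.65)–(5.67): `p̃_c^a(q) ≤ p_g(q)`)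

Claimed R42 (8)(c) in the cell INBOX at 2026-08-27T17:08:47Z by fkp-10a gen 350 under provision (ι) (coordinator fk-4 g257 closed 16:26Z 2026-08-27; the lane lead absorbs the registry word; silence = consent), addressed to the lane lead and the next seated coordinator fk-4 (ruling R137); lineage row FO-10a-g350 (self-suggested), package g350-volexp, label VX-E.
Support file of the `fk-continuity` cell (lineage fkp-10a, `--supports stmt-CriticalPhenomena-4575`); builds on
p205010 (kernel theorem, internal audit signed; external expert review pending).  No definitions, no named facts,
no sorries; standard axioms.  Box limits `P` of `φ^b_{Λ_n,p,q}` (`IsBoxLimit d b p q P`, either `b`), `0 < p < 1`,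
`q ≥ 1`.  UNCONDITIONAL structure in hypothesis form (the hypothesis is Grimmett's `L^a(p,q) = 0`); nothing is decided
about Conj. (5.85)/(5.54), FH / TP_FK or `p_c(q)`.

The tree has the volume decay rate `ζ^b(p,q) = lim -n⁻¹ log φ^b_{p,q}(|C_0| = n)` (Thm. (5.47)/Cor. (5.51),
`IsBoxLimit.exists_volumeDecayRate`), the radius decay rate `ψ^b(p,q) = lim -n⁻¹ log φ^b_{p,q}(0 ↔ ∂Λ_n)`
(Cor. (5.45), `IsBoxLimit.exists_radiusDecayRate`) and the directional rates of the two-point function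
(`IsBoxLimit.exists_decayRate`), with positivity only for `p < p_c(1)` (`VolumeDecayRatePositiveBelowPcOne`,
`DecayRatePositiveBelowPcOne`, Thm. (5.55)).  With Thm. (5.86) (`VolumeExponentialDecayCriterion` /
`VolumeExponentialDecayConsequences`) the positivity extends to the whole regime `L^a(p,q) = 0`, i.e. to
`p < p̃_c^a(q)` — Grimmett's "`ρ(p,q) > 0` when `p < p̃_c^∞(q)`" and `p̃_c(q) ≤ p_g(q)` of (5.67), in the tree's rate
vocabulary:

* `le_neg_log_div_of_le_mul_exp` (`P(A) ≤ K e^{-cn}`, `P(A) > 0` ⟹ `c - (log K)/n ≤ -n⁻¹ log P(A)`);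
* **`IsBoxLimit.exists_volumeDecayRate_pos_of_tendsto`** — `ζ^b(p,q) > 0`;
* **`IsBoxLimit.exists_radiusDecayRate_pos_of_tendsto`** — `ψ^b(p,q) > 0` (so `ξ^b(p,q) = 1/ψ^b < ∞`);
* **`IsBoxLimit.exists_decayRate_pos_of_tendsto`** — the two-point function `φ^b_{p,q}(0 ↔ nu)` decays exponentially
  along every `u ≠ 0`;
* `rcLimit` forms of the three.

## References

* G. Grimmett, *The Random-Cluster Model*, Springer 2006: §5.4 (5.42)–(5.47), Cor. (5.45), Cor. (5.51); §5.5
  (5.65)–(5.67); §5.6 (5.83)–(5.86). [Grimmett2006]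
* G. Grimmett, *Percolation*, 2nd ed., Springer 1999, Thms. (6.10), (6.75), (6.78). [GrimmettPercolation1999]
-/

noncomputable section

open scoped Classical Topology
open MeasureTheory Finset Filter

namespace Summit.CriticalPhenomena.PercolationContinuityZ3.Theorems

namespace FK

open Literature.Probability.LatticeModels Literature.Probability.Percolation
  Literature.Probability.Percolation.DCT16

variable {d : ℕ} {b : Bool} {p q : ℝ} {P : Measure (BondConfig (Site d))}

/-- From an exponential bound to a rate bound: if `0 < x ≤ K e^{-cn}` with `K > 0` and `n ≥ 1`, then
`c - (log K)/n ≤ -(1/n) log x` and `c - (log K)/n ≤ -log x / n`. [folklore] -/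
theorem le_neg_log_div_of_le_mul_exp {x K c : ℝ} {n : ℕ} (hn : 1 ≤ n) (hx : 0 < x) (hK : 0 < K)
    (h : x ≤ K * Real.exp (-(c * n))) :
    c - Real.log K / n ≤ -(1 / (n : ℝ)) * Real.log x ∧ c - Real.log K / n ≤ -Real.log x / n := by
  have hn0 : (0 : ℝ) < n := by exact_mod_cast hn
  have h2 : Real.log x ≤ Real.log K + -(c * n) := by
    rw [← Real.log_exp (-(c * n)), ← Real.log_mul hK.ne' (Real.exp_pos _).ne']
    exact Real.log_le_log hx h
  have h3 : -(1 / (n : ℝ)) * Real.log x ≥ -(1 / (n : ℝ)) * (Real.log K + -(c * n)) :=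
    mul_le_mul_of_nonpos_left h2 (by rw [neg_nonpos]; positivity)
  have h4 : -(1 / (n : ℝ)) * (Real.log K + -(c * n)) = c - Real.log K / n := by
    field_simp
    ring
  have h5 : -(1 / (n : ℝ)) * Real.log x = -Real.log x / n := by ring
  constructor
  · linarith
  · rw [← h5]; linarith

/-- **`ζ^b(p,q) > 0` below `p̃_c^a(q)`** (Grimmett 2006, Thm. (5.86) read through Thm. (5.47)/Cor. (5.51)): for a box
limit `P` of `φ^b_{Λ_n,p,q}` on `ℤ^d` (`d ≥ 1`, `0 < p < 1`, `q ≥ 1`, either `b`), if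
`n^{d-1} φ¹_{Λ_{an},p,q}(0 ↔ ∂Λ_n) → 0` for some integer `a ≥ 1`, then the volume decay rate is positive:
`∃ ζ > 0, -n⁻¹ log P(|C_0| = n) → ζ ∧ ∀ n ≥ 1, P(|C_0| = n) ≤ (q(1-p)/p)(2n+1)^d e^{-nζ}`.
[cite: Grimmett2006, §5.6 Thm. (5.86) with §5.4 Thm. (5.47), Cor. (5.51), (5.42)–(5.43)] -/
theorem IsBoxLimit.exists_volumeDecayRate_pos_of_tendsto (hd : 0 < d) (hP : IsBoxLimit d b p q P)
    (hp : p ∈ Set.Ioo (0 : ℝ) 1) (hq : 1 ≤ q) {a : ℕ} (ha : 1 ≤ a)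
    (hL : Tendsto (fun n : ℕ => (n : ℝ) ^ (d - 1) * regionWiredReal d p q (box d (a * n)) (siteToBoundary d n))
      atTop (𝓝 0)) :
    ∃ ζ : ℝ, 0 < ζ ∧
      Tendsto (fun n : ℕ => -(1 / (n : ℝ)) * Real.log (P.real {ω : BondConfig (Site d) | (openCluster ω 0).ncard = n}))
        atTop (𝓝 ζ) ∧
      ∀ n : ℕ, 1 ≤ n → P.real {ω : BondConfig (Site d) | (openCluster ω 0).ncard = n} ≤
        q * (1 - p) / p * ((2 * n + 1) ^ d : ℕ) * Real.exp (-(n * ζ)) := by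
  haveI := hP.isProbabilityMeasure
  have hp' : p ∈ Set.Icc (0 : ℝ) 1 := ⟨hp.1.le, hp.2.le⟩
  obtain ⟨ζ, -, hζ, hbound⟩ := hP.exists_volumeDecayRate hd hp hq
  obtain ⟨c, hc, K, hK, htail⟩ :=
    (hP.fkGibbs hp' hq).exists_real_clusterSizeGe_le_exp_of_tendsto hd hp' hq ha hL
  refine ⟨ζ, ?_, hζ, hbound⟩
  -- `P(|C_0| = n) > 0` and `P(|C_0| = n) ≤ P(|C_0| ≥ n) ≤ K e^{-cn}`
  have hpos : ∀ n : ℕ, 1 ≤ n → 0 < P.real {ω : BondConfig (Site d) | (openCluster ω 0).ncard = n} := fun n hn =>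
    (hP.real_ncard_inter_lexMin_pos hd hp hq hn).trans_le (measureReal_mono Set.inter_subset_left)
  have hsub : ∀ n : ℕ, 1 ≤ n →
      {ω : BondConfig (Site d) | (openCluster ω 0).ncard = n} ⊆ clusterSizeGe (0 : Site d) n := by
    intro n hn ω hω
    rw [Set.mem_setOf_eq] at hω
    rw [mem_clusterSizeGe]
    have hfin : (openCluster ω 0).Finite := Set.finite_of_ncard_pos (by omega)
    rw [← hfin.cast_ncard_eq, hω]
  have hlow : ∀ n : ℕ, 1 ≤ n →
      c - Real.log K / n ≤ -(1 / (n : ℝ)) * Real.log (P.real {ω : BondConfig (Site d) | (openCluster ω 0).ncard = n}) :=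
    fun n hn => (le_neg_log_div_of_le_mul_exp hn (hpos n hn) hK
      ((measureReal_mono (hsub n hn)).trans (htail n hn))).1
  have hlim : Tendsto (fun n : ℕ => c - Real.log K / n) atTop (𝓝 (c - 0)) :=
    tendsto_const_nhds.sub (tendsto_const_div_atTop_nhds_zero_nat _)
  rw [sub_zero] at hlim
  have hle : c ≤ ζ := by
    refine le_of_tendsto_of_tendsto' (hlim.comp (tendsto_add_atTop_nat 1)) (hζ.comp (tendsto_add_atTop_nat 1))
      fun n => ?_
    simp only [Function.comp]
    exact hlow (n + 1) (by omega)
  exact hc.trans_le hle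

/-- **`ψ^b(p,q) > 0` below `p̃_c^a(q)`** (Grimmett 2006, Thm. (5.86) with Cor. (5.45) and (5.65)–(5.67):
`p̃_c^a(q) ≤ p_g(q)`; the correlation length `ξ^b(p,q) = 1/ψ^b(p,q)` is finite there): for a box limit `P` of
`φ^b_{Λ_n,p,q}` on `ℤ^d` (`d ≥ 1`, `0 < p ≤ 1`, `q ≥ 1`, either `b`) and a coordinate direction `k`, if
`n^{d-1} φ¹_{Λ_{an},p,q}(0 ↔ ∂Λ_n) → 0` for some integer `a ≥ 1`, then
`∃ ψ > 0` which is the limit of `-n⁻¹ log P(0 ↔ n e_k)` and of `-n⁻¹ log P(0 ↔ ∂Λ_n)`, with the bounds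
`P(0 ↔ n e_k) ≤ e^{-nψ}`, `P(0 ↔ ∂Λ_n) ≤ 2d(2n+1)^{d-1} e^{-nψ}`. [cite: Grimmett2006, §5.6 Thm. (5.86) with Cor. (5.45), (5.65)–(5.67)] -/
theorem IsBoxLimit.exists_radiusDecayRate_pos_of_tendsto (hd : 0 < d) (hP : IsBoxLimit d b p q P)
    (hp : p ∈ Set.Ioc (0 : ℝ) 1) (hq : 1 ≤ q) {a : ℕ} (ha : 1 ≤ a)
    (hL : Tendsto (fun n : ℕ => (n : ℝ) ^ (d - 1) * regionWiredReal d p q (box d (a * n)) (siteToBoundary d n))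
      atTop (𝓝 0)) (k : Fin d) :
    ∃ ψ : ℝ, 0 < ψ ∧
      Tendsto (fun n : ℕ => -Real.log (P.real (openConn (0 : Site d) (n • (Pi.single k (1 : ℤ) : Site d)))) / n)
        atTop (𝓝 ψ) ∧
      Tendsto (fun n : ℕ => -Real.log (P.real (siteToBoundary d n)) / n) atTop (𝓝 ψ) ∧
      (∀ n : ℕ, P.real (openConn (0 : Site d) (n • (Pi.single k (1 : ℤ) : Site d))) ≤ Real.exp (-(n * ψ))) ∧
      ∀ n : ℕ, P.real (siteToBoundary d n) ≤ 2 * d * (2 * n + 1) ^ (d - 1) * Real.exp (-(n * ψ)) := by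
  haveI := hP.isProbabilityMeasure
  have hp' : p ∈ Set.Icc (0 : ℝ) 1 := ⟨hp.1.le, hp.2⟩
  obtain ⟨ψ, -, hlimA, hlimR, hbdA, hbdR⟩ := hP.exists_radiusDecayRate hp hq k
  obtain ⟨c, hc, K, hK, hcn⟩ :=
    (hP.fkGibbs hp' hq).exists_real_siteToBoundary_le_exp_of_tendsto hd hp' hq ha hL
  refine ⟨ψ, ?_, hlimA, hlimR, hbdA, hbdR⟩
  -- positivity of the radius law and `c - (log K)/n ≤ -n⁻¹ log P(0 ↔ ∂Λ_n)` for `n ≥ 1`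
  have hβpos : ∀ n : ℕ, 0 < P.real (siteToBoundary d n) := fun n =>
    (hP.real_openConn_pos hp hq 0 _).trans_le
      (real_openConn_le_real_siteToBoundary_of_notMem (hP.ae_subset_edgeSet hp' (one_pos.trans_le hq))
        (succ_nsmul_single_one_notMem_box k n))
  have hlim : Tendsto (fun n : ℕ => c - Real.log K / n) atTop (𝓝 (c - 0)) :=
    tendsto_const_nhds.sub (tendsto_const_div_atTop_nhds_zero_nat _)
  rw [sub_zero] at hlim
  refine hc.trans_le (le_of_tendsto_of_tendsto hlim hlimR ?_)
  filter_upwards [eventually_ge_atTop 1] with n hn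
  exact (le_neg_log_div_of_le_mul_exp hn (hβpos n) hK (hcn n hn)).2

/-- **Exponential decay of the two-point function in every direction below `p̃_c^a(q)`**: for a box limit `P` of
`φ^b_{Λ_n,p,q}` on `ℤ^d` (`d ≥ 1`, `0 < p ≤ 1`, `q ≥ 1`, either `b`), `u ≠ 0`, and the hypothesis
`n^{d-1} φ¹_{Λ_{an},p,q}(0 ↔ ∂Λ_n) → 0` (some integer `a ≥ 1`): the directional rate of `ConnectivityDecayRate.lean`
is positive — `∃ ψ > 0, ψ ≤ -log P(0 ↔ u) ∧ -n⁻¹ log P(0 ↔ nu) → ψ ∧ ∀ n, P(0 ↔ nu) ≤ e^{-nψ}`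
(`nu ∉ Λ_{n-1}`, so `P(0 ↔ nu) ≤ P(0 ↔ ∂Λ_{n-1}) ≤ K e^{-c(n-1)}`). [cite: Grimmett2006, §5.6 Thm. (5.86) with §5.4 (5.42)–(5.44)] -/
theorem IsBoxLimit.exists_decayRate_pos_of_tendsto (hd : 0 < d) (hP : IsBoxLimit d b p q P)
    (hp : p ∈ Set.Ioc (0 : ℝ) 1) (hq : 1 ≤ q) {a : ℕ} (ha : 1 ≤ a)
    (hL : Tendsto (fun n : ℕ => (n : ℝ) ^ (d - 1) * regionWiredReal d p q (box d (a * n)) (siteToBoundary d n))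
      atTop (𝓝 0)) {u : Site d} (hu : u ≠ 0) :
    ∃ ψ : ℝ, 0 < ψ ∧ ψ ≤ -Real.log (P.real (openConn (0 : Site d) u)) ∧
      Tendsto (fun n : ℕ => -Real.log (P.real (openConn (0 : Site d) (n • u))) / n) atTop (𝓝 ψ) ∧
      ∀ n : ℕ, P.real (openConn (0 : Site d) (n • u)) ≤ Real.exp (-(n * ψ)) := by
  haveI := hP.isProbabilityMeasure
  have hp' : p ∈ Set.Icc (0 : ℝ) 1 := ⟨hp.1.le, hp.2⟩
  obtain ⟨ψ, -, hψ1, hlim, hbd⟩ := hP.exists_decayRate hp hq u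
  obtain ⟨c, hc, K, hK, hcn⟩ :=
    (hP.fkGibbs hp' hq).exists_real_siteToBoundary_le_exp_of_tendsto hd hp' hq ha hL
  refine ⟨ψ, ?_, hψ1, hlim, hbd⟩
  -- `n • u ∉ Λ_{n-1}` for `n ≥ 1`
  obtain ⟨i, hi⟩ : ∃ i, u i ≠ 0 := by
    by_contra h
    push Not at h
    exact hu (funext h)
  have hout : ∀ n : ℕ, 1 ≤ n → n • u ∉ box d (n - 1) := by
    intro n hn hmem
    rw [mem_box] at hmem
    have h := hmem i
    simp only [Pi.smul_apply, nsmul_eq_mul] at h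
    push_cast [Nat.cast_sub hn] at h
    have hui : 1 ≤ |u i| := Int.one_le_abs hi
    have hn1 : (1 : ℤ) ≤ n := by exact_mod_cast hn
    rcases le_or_gt 0 (u i) with h0 | h0
    · rw [abs_of_nonneg h0] at hui
      nlinarith [h.2]
    · rw [abs_of_neg h0] at hui
      nlinarith [h.1]
  -- `(c(n-1) - log K)/n → c` is eventually below `-n⁻¹ log P(0 ↔ nu)`
  have hcl : Tendsto (fun n : ℕ => (c * ((n : ℝ) - 1) - Real.log K) / n) atTop (𝓝 c) := by
    have h1 : Tendsto (fun n : ℕ => ((n : ℝ) - 1) / n) atTop (𝓝 1) := by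
      have h := (tendsto_const_nhds (x := (1 : ℝ))).sub tendsto_one_div_atTop_nhds_zero_nat
      rw [sub_zero] at h
      refine h.congr' ?_
      filter_upwards [eventually_ge_atTop 1] with n hn
      have hn' : (n : ℝ) ≠ 0 := (Nat.cast_pos.2 hn).ne'
      field_simp
    have h2 := (h1.const_mul c).sub (tendsto_const_div_atTop_nhds_zero_nat (Real.log K))
    rw [mul_one, sub_zero] at h2
    refine h2.congr' ?_
    filter_upwards [eventually_ge_atTop 1] with n hn
    have hn' : (n : ℝ) ≠ 0 := (Nat.cast_pos.2 hn).ne'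
    field_simp
  refine hc.trans_le (le_of_tendsto_of_tendsto hcl hlim ?_)
  filter_upwards [eventually_ge_atTop 2] with n hn
  have hn' : (0 : ℝ) < n := Nat.cast_pos.2 (by omega)
  have hτpos : 0 < P.real (openConn (0 : Site d) (n • u)) := hP.real_openConn_pos hp hq 0 _
  have h0 : P.real (openConn (0 : Site d) (n • u)) ≤ K * Real.exp (-(c * ((n - 1 : ℕ) : ℝ))) :=
    (real_openConn_le_real_siteToBoundary_of_notMem (hP.ae_subset_edgeSet hp' (one_pos.trans_le hq))
      (hout n (by omega))).trans (hcn (n - 1) (by omega))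
  have h1 : Real.log (P.real (openConn (0 : Site d) (n • u))) ≤ Real.log K + -(c * ((n - 1 : ℕ) : ℝ)) := by
    rw [← Real.log_exp (-(c * ((n - 1 : ℕ) : ℝ))), ← Real.log_mul hK.ne' (Real.exp_pos _).ne']
    exact Real.log_le_log hτpos h0
  rw [Nat.cast_sub (by omega : 1 ≤ n), Nat.cast_one] at h1
  rw [div_le_div_iff_of_pos_right hn']
  linarith

/-- **`ζ^b(p,q) > 0` for `φ^b_{p,q} = rcLimit d b p q` below `p̃_c^a(q)`** (`d ≥ 1`, `0 < p < 1`, `q ≥ 1`, either `b`).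
[cite: Grimmett2006, §5.6 Thm. (5.86) with Thm. (5.47)] -/
theorem exists_volumeDecayRate_pos_rcLimit_of_tendsto (hd : 0 < d) (b : Bool) (hp : p ∈ Set.Ioo (0 : ℝ) 1)
    (hq : 1 ≤ q) {a : ℕ} (ha : 1 ≤ a)
    (hL : Tendsto (fun n : ℕ => (n : ℝ) ^ (d - 1) * regionWiredReal d p q (box d (a * n)) (siteToBoundary d n))
      atTop (𝓝 0)) :
    ∃ ζ : ℝ, 0 < ζ ∧
      Tendsto (fun n : ℕ => -(1 / (n : ℝ)) *
          Real.log ((rcLimit d b p q).real {ω : BondConfig (Site d) | (openCluster ω 0).ncard = n})) atTop (𝓝 ζ) ∧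
      ∀ n : ℕ, 1 ≤ n → (rcLimit d b p q).real {ω : BondConfig (Site d) | (openCluster ω 0).ncard = n} ≤
        q * (1 - p) / p * ((2 * n + 1) ^ d : ℕ) * Real.exp (-(n * ζ)) :=
  (isBoxLimit_rcLimit b ⟨hp.1.le, hp.2.le⟩ hq).exists_volumeDecayRate_pos_of_tendsto hd hp hq ha hL

/-- **`ψ^b(p,q) > 0` for `φ^b_{p,q} = rcLimit d b p q` below `p̃_c^a(q)`**, radius and axis forms (`d ≥ 1`,
`0 < p ≤ 1`, `q ≥ 1`, either `b`). [cite: Grimmett2006, §5.6 Thm. (5.86) with Cor. (5.45), (5.67)] -/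
theorem exists_radiusDecayRate_pos_rcLimit_of_tendsto (hd : 0 < d) (b : Bool) (hp : p ∈ Set.Ioc (0 : ℝ) 1)
    (hq : 1 ≤ q) {a : ℕ} (ha : 1 ≤ a)
    (hL : Tendsto (fun n : ℕ => (n : ℝ) ^ (d - 1) * regionWiredReal d p q (box d (a * n)) (siteToBoundary d n))
      atTop (𝓝 0)) (k : Fin d) :
    ∃ ψ : ℝ, 0 < ψ ∧
      Tendsto (fun n : ℕ => -Real.log ((rcLimit d b p q).real
          (openConn (0 : Site d) (n • (Pi.single k (1 : ℤ) : Site d)))) / n) atTop (𝓝 ψ) ∧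
      Tendsto (fun n : ℕ => -Real.log ((rcLimit d b p q).real (siteToBoundary d n)) / n) atTop (𝓝 ψ) ∧
      (∀ n : ℕ, (rcLimit d b p q).real (openConn (0 : Site d) (n • (Pi.single k (1 : ℤ) : Site d))) ≤
          Real.exp (-(n * ψ))) ∧
      ∀ n : ℕ, (rcLimit d b p q).real (siteToBoundary d n) ≤ 2 * d * (2 * n + 1) ^ (d - 1) * Real.exp (-(n * ψ)) :=
  (isBoxLimit_rcLimit b ⟨hp.1.le, hp.2⟩ hq).exists_radiusDecayRate_pos_of_tendsto hd hp hq ha hL k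

/-- **Directional exponential decay of the two-point function of `φ^b_{p,q} = rcLimit d b p q` below
`p̃_c^a(q)`** (`d ≥ 1`, `0 < p ≤ 1`, `q ≥ 1`, either `b`, `u ≠ 0`). [cite: Grimmett2006, §5.6 Thm. (5.86) with §5.4 (5.42)–(5.44)] -/
theorem exists_decayRate_pos_rcLimit_of_tendsto (hd : 0 < d) (b : Bool) (hp : p ∈ Set.Ioc (0 : ℝ) 1)
    (hq : 1 ≤ q) {a : ℕ} (ha : 1 ≤ a)
    (hL : Tendsto (fun n : ℕ => (n : ℝ) ^ (d - 1) * regionWiredReal d p q (box d (a * n)) (siteToBoundary d n))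
      atTop (𝓝 0)) {u : Site d} (hu : u ≠ 0) :
    ∃ ψ : ℝ, 0 < ψ ∧ ψ ≤ -Real.log ((rcLimit d b p q).real (openConn (0 : Site d) u)) ∧
      Tendsto (fun n : ℕ => -Real.log ((rcLimit d b p q).real (openConn (0 : Site d) (n • u))) / n) atTop (𝓝 ψ) ∧
      ∀ n : ℕ, (rcLimit d b p q).real (openConn (0 : Site d) (n • u)) ≤ Real.exp (-(n * ψ)) :=
  (isBoxLimit_rcLimit b ⟨hp.1.le, hp.2⟩ hq).exists_decayRate_pos_of_tendsto hd hp hq ha hL hu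

end FK

end Summit.CriticalPhenomena.PercolationContinuityZ3.Theorems

end
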